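import Mathlib
import HarnessLib
import Summits.Ventures.LatticeQCDFlow.Scaling.AutoregressiveProposalAffinityChain

/-!
# LatticeQCDFlow / Scaling — Le Cam along the order: UNIFORM per-coordinate total-variation deficits
# `t_k` give the multiplicative acceptance ceiling `ā ≤ ∏_k (1 − t_k²) ≤ exp(−Σ_k t_k²)`

HONEST FRAMING: exact (Metropolis-corrected) sampling algorithms for lattice gauge theory;
figures of merit are autocorrelation/cost numbers at stated couplings and volumes; no
continuum-physics claim.

Venture `LatticeQCDFlow` (cell pub-lqcd), topic `Scaling`, FANOUT row 30 (lean-1, GEN-20) — OUR WORK on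
THEORY-2.md §4 row C5, the `L¹` form of `Scaling/AutoregressiveProposalAffinityChain` (uniform affinity
deficits `θ_k` multiply: `ā ≤ (∏θ_k)²`).  The cell's context bounds are in the `L¹` / total-variation
currency; Le Cam's inequality `BC² + TV² ≤ 1` converts a uniform total-variation deficit into a uniform
affinity deficit, context by context.

## What is proved (all [ours]; Le Cam 1973 NAMED, proved here in the form needed)

* §1 **`sq_integral_abs_sub_le_four_mul_one_sub_sq_bc`** — for bounded measurable probability densities
  `p, q ≥ 0` on a probability space: `(∫|p − q|)² ≤ 4 (1 − (∫√(pq))²)`, i.e. `BC² ≤ 1 − TV²`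
  (pointwise `|p − q| = |√p − √q|(√p + √q) ≤ (λ(√p − √q)² + (√p + √q)²/λ)/2`, integrate, optimise `λ`).
* §2 **`step_affinity_le_of_tv`** — ONE STEP: if the conditional `L¹` distance is uniformly large,
  `2t·A_{insert a s}F(ω) ≤ ∫|A_sF − q·A_{insert a s}F|(ω[a↦v]) dμ(v)` for every context `ω` (`0 ≤ t`),
  then `∫√(q·A_sF)(ω[a↦v]) dμ(v) ≤ √(1 − t²)·√(A_{insert a s}F(ω))` — the affinity hypothesis of the
  multiplicative chain with `θ = √(1 − t²)`.
* §3 **`meanAccept_arHybrid_le_prod_one_sub_sq`**, **`meanAccept_arHybrid_le_exp_neg_sum_sq`** — along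
  a duplicate-free autoregressive block with uniform per-step total-variation deficits `t_{a_k} ∈ [0, 1]`:
  `ā ≤ ∏_k (1 − t_{a_k}²) ≤ exp(−Σ_k t_{a_k}²)`.

READING (value-free): an exact autoregressive / flow sampler whose conditionals at `m` coordinates are,
for EVERY context, at total-variation distance `≥ t` from the exact conditionals accepts at rate
`≤ (1 − t²)^m ≤ e^{−mt²}` in equilibrium.  NOT CLAIMED: the cell's gauge floors are ON AVERAGE over the
exact context law (`Scaling/AutoregressiveGauge*`), not uniform, so they do not feed this file — they feed
the loss / `τ_int` files (`Scaling/AutoregressiveProposalKLPinsker`, `…GaugeKLExtensive`,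
`…GaugeSlowingDown`); nothing here beyond the acceptance.  No `def`, no `sorry`, nothing cited as a fact.
-/

noncomputable section

namespace Summit.Ventures.LatticeQCDFlow.Theory2.Autoregressive

open MeasureTheory Function Set
open Summit.Ventures.LatticeQCDFlow.Exactness

/-! ## §1 Le Cam: `BC² ≤ 1 − TV²` -/

/-- **Le Cam's inequality** for two bounded measurable probability densities `p, q ≥ 0` on a probability
space: `(∫|p − q| dν)² ≤ 4·(1 − (∫ √(p q) dν)²)`. [Le Cam 1973 — proved here] -/
theorem sq_integral_abs_sub_le_four_mul_one_sub_sq_bc {Y : Type*} [MeasurableSpace Y] {ν : Measure Y}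
    [IsProbabilityMeasure ν] {p q : Y → ℝ} (hpm : Measurable p) (hp0 : ∀ y, 0 ≤ p y) {Cp : ℝ}
    (hpb : ∀ y, p y ≤ Cp) (hp1 : ∫ y, p y ∂ν = 1) (hqm : Measurable q) (hq0 : ∀ y, 0 ≤ q y) {Cq : ℝ}
    (hqb : ∀ y, q y ≤ Cq) (hq1 : ∫ y, q y ∂ν = 1) :
    (∫ y, |p y - q y| ∂ν) ^ 2 ≤ 4 * (1 - (∫ y, Real.sqrt (p y * q y) ∂ν) ^ 2) := by
  have hbd : ∀ {f : Y → ℝ} (_ : Measurable f) {C : ℝ} (_ : ∀ y, |f y| ≤ C), Integrable f ν :=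
    fun hf C hC => Integrable.mono' (integrable_const C) hf.aestronglyMeasurable
      (ae_of_all _ fun y => by rw [Real.norm_eq_abs]; exact hC y)
  have hpabs : ∀ y, |p y| ≤ Cp := fun y => by rw [abs_of_nonneg (hp0 y)]; exact hpb y
  have hqabs : ∀ y, |q y| ≤ Cq := fun y => by rw [abs_of_nonneg (hq0 y)]; exact hqb y
  have hpi : Integrable p ν := hbd hpm hpabs
  have hqi : Integrable q ν := hbd hqm hqabs
  -- square roots
  set a : Y → ℝ := fun y => Real.sqrt (p y) with ha
  set b : Y → ℝ := fun y => Real.sqrt (q y) with hb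
  have ham : Measurable a := hpm.sqrt
  have hbm : Measurable b := hqm.sqrt
  have ha0 : ∀ y, 0 ≤ a y := fun y => Real.sqrt_nonneg _
  have hb0 : ∀ y, 0 ≤ b y := fun y => Real.sqrt_nonneg _
  have haa : ∀ y, a y * a y = p y := fun y => Real.mul_self_sqrt (hp0 y)
  have hbb : ∀ y, b y * b y = q y := fun y => Real.mul_self_sqrt (hq0 y)
  have hab : ∀ y, a y * b y = Real.sqrt (p y * q y) := fun y => (Real.sqrt_mul (hp0 y) (q y)).symm
  have habs_a : ∀ y, |a y| ≤ Real.sqrt Cp := fun y => by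
    rw [abs_of_nonneg (ha0 y)]; exact Real.sqrt_le_sqrt (hpb y)
  have habs_b : ∀ y, |b y| ≤ Real.sqrt Cq := fun y => by
    rw [abs_of_nonneg (hb0 y)]; exact Real.sqrt_le_sqrt (hqb y)
  have hBCi : Integrable (fun y => Real.sqrt (p y * q y)) ν :=
    hbd (hpm.mul hqm).sqrt (C := Real.sqrt Cp * Real.sqrt Cq) (fun y => by
      rw [← hab, abs_mul]; exact mul_le_mul (habs_a y) (habs_b y) (abs_nonneg _) (Real.sqrt_nonneg _))
  set X : ℝ := ∫ y, |p y - q y| ∂ν with hX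
  set B₀ : ℝ := ∫ y, Real.sqrt (p y * q y) ∂ν with hB₀
  -- `A = ∫(a − b)² = 2 − 2 B₀`, `B = ∫(a + b)² = 2 + 2 B₀`
  have hIpq : Integrable (fun y => p y + q y) ν := hpi.add hqi
  have hI2 : Integrable (fun y => 2 * Real.sqrt (p y * q y)) ν := hBCi.const_mul 2
  have eA : ∀ y, (a y - b y) ^ 2 = p y + q y - 2 * Real.sqrt (p y * q y) := fun y => by
    rw [← hab, ← haa, ← hbb]; ring
  have eB : ∀ y, (a y + b y) ^ 2 = p y + q y + 2 * Real.sqrt (p y * q y) := fun y => by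
    rw [← hab, ← haa, ← hbb]; ring
  have hAval : ∫ y, (a y - b y) ^ 2 ∂ν = 2 - 2 * B₀ := by
    simp_rw [eA]
    rw [integral_sub hIpq hI2, integral_add hpi hqi, integral_const_mul, hp1, hq1]
    ring
  have hBval : ∫ y, (a y + b y) ^ 2 ∂ν = 2 + 2 * B₀ := by
    simp_rw [eB]
    rw [integral_add hIpq hI2, integral_add hpi hqi, integral_const_mul, hp1, hq1]
    ring
  have hB0 : 0 ≤ B₀ := integral_nonneg fun y => Real.sqrt_nonneg _
  have hX0 : 0 ≤ X := integral_nonneg fun y => abs_nonneg _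
  have hAi : Integrable (fun y => (a y - b y) ^ 2) ν := by
    rw [show (fun y => (a y - b y) ^ 2) = fun y => p y + q y - 2 * Real.sqrt (p y * q y) from funext eA]
    exact hIpq.sub hI2
  have hBi : Integrable (fun y => (a y + b y) ^ 2) ν := by
    rw [show (fun y => (a y + b y) ^ 2) = fun y => p y + q y + 2 * Real.sqrt (p y * q y) from funext eB]
    exact hIpq.add hI2
  -- `X ≤ (λ A + B/λ)/2` for every `λ > 0`
  have hlin : ∀ lam : ℝ, 0 < lam → X ≤ (lam * (2 - 2 * B₀) + (2 + 2 * B₀) / lam) / 2 := by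
    intro lam hlam
    have hpt : ∀ y, |p y - q y| ≤ (lam * (a y - b y) ^ 2 + (a y + b y) ^ 2 / lam) / 2 := by
      intro y
      have e1 : |p y - q y| = |a y - b y| * (a y + b y) := by
        rw [← haa, ← hbb, show a y * a y - b y * b y = (a y - b y) * (a y + b y) by ring, abs_mul,
          abs_of_nonneg (add_nonneg (ha0 y) (hb0 y))]
      rw [e1]
      -- AM–GM: `u w ≤ (λ u² + w²/λ)/2`
      have h := sq_nonneg (lam * |a y - b y| - (a y + b y))
      have e2 : (lam * (a y - b y) ^ 2 + (a y + b y) ^ 2 / lam) / 2 - |a y - b y| * (a y + b y)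
          = (lam * |a y - b y| - (a y + b y)) ^ 2 / (2 * lam) := by
        rw [← sq_abs (a y - b y)]
        field_simp
        ring
      have : 0 ≤ (lam * |a y - b y| - (a y + b y)) ^ 2 / (2 * lam) := div_nonneg h (by positivity)
      linarith
    have hA' : Integrable (fun y => lam * (a y - b y) ^ 2) ν := hAi.const_mul lam
    have hB' : Integrable (fun y => (a y + b y) ^ 2 / lam) ν := hBi.div_const lam
    have hgi : Integrable (fun y => (lam * (a y - b y) ^ 2 + (a y + b y) ^ 2 / lam) / 2) ν :=
      (hA'.add hB').div_const 2
    have hI := integral_mono_of_nonneg (ae_of_all _ fun y => abs_nonneg _) hgi (ae_of_all _ hpt)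
    rw [integral_div, integral_add hA' hB', integral_const_mul, integral_div, hAval, hBval] at hI
    exact hI
  -- optimise: `λ = B/X`
  have hBpos : 0 < 2 + 2 * B₀ := by linarith
  rcases hX0.eq_or_lt with hX00 | hXpos
  · rw [← hX00]
    have hB1 : B₀ ≤ 1 := by
      -- `B₀ ≤ 1` from `A ≥ 0`
      have : 0 ≤ 2 - 2 * B₀ := by rw [← hAval]; exact integral_nonneg fun y => sq_nonneg _
      linarith
    nlinarith
  · have h := hlin ((2 + 2 * B₀) / X) (div_pos hBpos hXpos)
    have e : ((2 + 2 * B₀) / X * (2 - 2 * B₀) + (2 + 2 * B₀) / ((2 + 2 * B₀) / X)) / 2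
        = ((2 + 2 * B₀) * (2 - 2 * B₀) / X + X) / 2 := by
      field_simp
    rw [e] at h
    have h2 : X ≤ (2 + 2 * B₀) * (2 - 2 * B₀) / X := by linarith
    rw [le_div_iff₀ hXpos] at h2
    nlinarith

/-! ## §2 One step: a uniform `L¹` deficit is a uniform affinity deficit -/

variable {ι : Type*} [Fintype ι] [DecidableEq ι] {X : Type*} [MeasurableSpace X]
variable (μ : Measure X) [IsProbabilityMeasure μ]

/-- **ONE STEP, Le Cam form.**  `a ∉ s`; `G ≥ 0` bounded measurable with `A_{insert a s}G > 0`;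
`q ≥ 0` bounded measurable, normalised in `a`; `0 ≤ t`.  If for EVERY context `ω`
`2t·A_{insert a s}G(ω) ≤ ∫|A_sG − q·A_{insert a s}G|(ω[a↦v]) dμ(v)` (the conditional total variation at
the context `ω` is at least `t`), then `∫√(q·A_sG)(ω[a↦v]) dμ(v) ≤ √(1 − t²)·√(A_{insert a s}G(ω))`.
[ours] -/
theorem step_affinity_le_of_tv {a : ι} {s : Finset ι} (ha : a ∉ s) {qa G : (ι → X) → ℝ}
    (hqm : Measurable qa) (hq0 : ∀ ω, 0 ≤ qa ω) {Cq : ℝ} (hqb : ∀ ω, qa ω ≤ Cq)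
    (hq1 : ∀ ω, ∫ v, qa (update ω a v) ∂μ = 1)
    (hGm : Measurable G) (hG0 : ∀ ω, 0 ≤ G ω) {CG : ℝ} (hGb : ∀ ω, G ω ≤ CG)
    (hMpos : ∀ ω, 0 < coordAvg μ (insert a s) G ω) {t : ℝ} (ht : 0 ≤ t)
    (htv : ∀ ω, 2 * t * coordAvg μ (insert a s) G ω ≤
      ∫ v, |coordAvg μ s G (update ω a v) - qa (update ω a v) * coordAvg μ (insert a s) G (update ω a v)| ∂μ)
    (ω : ι → X) :
    ∫ v, Real.sqrt (qa (update ω a v) * coordAvg μ s G (update ω a v)) ∂μ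
      ≤ Real.sqrt (1 - t ^ 2) * Real.sqrt (coordAvg μ (insert a s) G ω) := by
  set N := coordAvg μ s G with hN
  set M := coordAvg μ (insert a s) G with hM
  have hGabs : ∀ ω, |G ω| ≤ CG := fun ω => by rw [abs_of_nonneg (hG0 ω)]; exact hGb ω
  have hNm : Measurable N := measurable_coordAvg μ s hGm
  have hN0 : ∀ ω, 0 ≤ N ω := fun ω => (coordAvg_mem_Icc μ s hGm hG0 hGb ω).1
  have hNb : ∀ ω, N ω ≤ CG := fun ω => (coordAvg_mem_Icc μ s hGm hG0 hGb ω).2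
  have hMa : ∀ ω v, M (update ω a v) = M ω := fun ω v => coordAvg_insert_update μ s a G ω v
  have hM0 : 0 < M ω := hMpos ω
  -- the two densities at the context `ω`
  set p : X → ℝ := fun v => N (update ω a v) / M ω with hp
  set qv : X → ℝ := fun v => qa (update ω a v) with hqv
  have hpm : Measurable p := (hNm.comp (measurable_update ω)).div_const _
  have hp0 : ∀ v, 0 ≤ p v := fun v => div_nonneg (hN0 _) hM0.le
  have hpb : ∀ v, p v ≤ CG / M ω := fun v => div_le_div_of_nonneg_right (hNb _) hM0.le
  have hp1 : ∫ v, p v ∂μ = 1 := by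
    rw [hp]; dsimp only
    rw [integral_div, hN, ← coordAvg_insert_eq_integral_coordAvg_update μ ha hGm hGabs ω, ← hM]
    exact div_self hM0.ne'
  have hqvm : Measurable qv := hqm.comp (measurable_update ω)
  have hlecam := sq_integral_abs_sub_le_four_mul_one_sub_sq_bc hpm hp0 hpb hp1 hqvm (fun v => hq0 _)
    (fun v => hqb _) (hq1 ω)
  -- identify: `∫|p − qv| = (∫|N − qa M|(ω[a↦v]))/M(ω) ≥ 2t` and `∫√(p qv) = (∫√(qa N)(ω[a↦v]))/√M(ω)`
  have hMne : M ω ≠ 0 := hM0.ne'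
  have eTV : ∫ v, |p v - qv v| ∂μ = (∫ v, |N (update ω a v) - qa (update ω a v) * M (update ω a v)| ∂μ) / M ω := by
    rw [eq_div_iff hMne, ← integral_mul_const]
    refine integral_congr_ae (ae_of_all _ fun v => ?_)
    rw [hp, hqv]; dsimp only
    rw [hMa ω v, ← abs_of_pos hM0, ← abs_mul, abs_of_pos hM0]
    congr 1
    field_simp
  have eBC : ∫ v, Real.sqrt (p v * qv v) ∂μ =
      (∫ v, Real.sqrt (qa (update ω a v) * N (update ω a v)) ∂μ) / Real.sqrt (M ω) := by
    rw [eq_div_iff (Real.sqrt_pos.2 hM0).ne', ← integral_mul_const]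
    refine integral_congr_ae (ae_of_all _ fun v => ?_)
    rw [hp, hqv]; dsimp only
    rw [← Real.sqrt_mul (mul_nonneg (hp0 v) (hq0 _)) (M ω)]
    congr 1
    rw [hp]; dsimp only
    field_simp
  have hTV : 2 * t ≤ ∫ v, |p v - qv v| ∂μ := by
    rw [eTV, le_div_iff₀ hM0]
    exact htv ω
  -- `BC² ≤ 1 − TV² ≤ 1 − t²`
  set BC : ℝ := ∫ v, Real.sqrt (p v * qv v) ∂μ with hBCdef
  have hBC0 : 0 ≤ BC := integral_nonneg fun v => Real.sqrt_nonneg _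
  have h2t : 0 ≤ 2 * t := by positivity
  have hsq : (2 * t) ^ 2 ≤ (∫ v, |p v - qv v| ∂μ) ^ 2 := pow_le_pow_left₀ h2t hTV 2
  have hBC : BC ^ 2 ≤ 1 - t ^ 2 := by nlinarith [hlecam, hsq]
  have hBCle : BC ≤ Real.sqrt (1 - t ^ 2) := by
    rw [← Real.sqrt_sq hBC0]; exact Real.sqrt_le_sqrt hBC
  have hgoal : ∫ v, Real.sqrt (qa (update ω a v) * N (update ω a v)) ∂μ = BC * Real.sqrt (M ω) := by
    rw [eBC, div_mul_cancel₀ _ (Real.sqrt_pos.2 hM0).ne']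
  rw [hgoal]
  exact mul_le_mul_of_nonneg_right hBCle (Real.sqrt_nonneg _)

/-! ## §3 Along the order -/

/-- **THE MULTIPLICATIVE CEILING FROM UNIFORM TOTAL-VARIATION DEFICITS.**  Target weight `F` squeezed
between positive constants; an autoregressive block `l` of distinct coordinates with conditionals
`q_a ≥ 0` bounded measurable and normalised in `a`; `t_a ∈ [0, 1]`; at every step `(a_k, s_k)` and every
context `ω`, `2t_{a_k}·A_{s_{k−1}}F(ω) ≤ ∫|A_{s_k}F − q_{a_k}A_{s_{k−1}}F|(ω[a_k↦v]) dμ(v)`.  Then the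
equilibrium acceptance of the exact sampler with the hybrid proposal satisfies `ā ≤ ∏_k (1 − t_{a_k}²)`.
[ours] -/
theorem meanAccept_arHybrid_le_prod_one_sub_sq {q : ι → (ι → X) → ℝ} (hqm : ∀ a, Measurable (q a))
    (hq0 : ∀ a ω, 0 ≤ q a ω) {Cq : ℝ} (hqb : ∀ a ω, q a ω ≤ Cq) (hCq : 0 ≤ Cq)
    (hq1 : ∀ a ω, ∫ v, q a (update ω a v) ∂μ = 1)
    {F : (ι → X) → ℝ} (hFm : Measurable F) {cF CF : ℝ} (hcF : 0 < cF) (hFlo : ∀ ω, cF ≤ F ω)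
    (hFhi : ∀ ω, F ω ≤ CF) {t : ι → ℝ} (ht0 : ∀ a, 0 ≤ t a) (ht1 : ∀ a, t a ≤ 1)
    (l : List ι) (hl : l.Nodup) (hpw : l.Pairwise (fun a b => ∀ ω v, q a (update ω b v) = q a ω))
    (htv : ∀ c ∈ l.zip l.tails.tail, ∀ ω : ι → X,
      2 * t c.1 * coordAvg μ (c.1 :: c.2).toFinset F ω ≤
        ∫ v, |coordAvg μ c.2.toFinset F (update ω c.1 v) -
          q c.1 (update ω c.1 v) * coordAvg μ (c.1 :: c.2).toFinset F (update ω c.1 v)| ∂μ) :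
    ∫ x, ∫ y, min
        (F x / (∫ ω, F ω ∂Measure.pi (fun _ : ι => μ)) *
          ((l.map fun b => q b y).prod * coordAvg μ l.toFinset F y /
            ∫ ω, F ω ∂Measure.pi (fun _ : ι => μ)))
        (F y / (∫ ω, F ω ∂Measure.pi (fun _ : ι => μ)) *
          ((l.map fun b => q b x).prod * coordAvg μ l.toFinset F x /
            ∫ ω, F ω ∂Measure.pi (fun _ : ι => μ)))
        ∂Measure.pi (fun _ : ι => μ) ∂Measure.pi (fun _ : ι => μ)
      ≤ (l.map fun a => 1 - t a ^ 2).prod := by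
  have hF0 : ∀ ω, 0 ≤ F ω := fun ω => hcF.le.trans (hFlo ω)
  have hFabs : ∀ ω, |F ω| ≤ CF := fun ω => by rw [abs_of_nonneg (hF0 ω)]; exact hFhi ω
  have hZpos : 0 < ∫ ω, F ω ∂Measure.pi (fun _ : ι => μ) := by
    have h1 : ∫ _, cF ∂Measure.pi (fun _ : ι => μ) ≤ ∫ ω, F ω ∂Measure.pi (fun _ : ι => μ) :=
      integral_mono (integrable_const cF) (integrable_pi_of_abs_le μ hFm hFabs) hFlo
    have h2 : ∫ _, cF ∂Measure.pi (fun _ : ι => μ) = cF := by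
      rw [integral_const, smul_eq_mul, Measure.real, measure_univ, ENNReal.toReal_one, one_mul]
    linarith
  -- the affinity hypothesis with `θ_a = √(1 − t_a²)`
  have hθ0 : ∀ a, 0 ≤ Real.sqrt (1 - t a ^ 2) := fun a => Real.sqrt_nonneg _
  have hθ : ∀ c ∈ l.zip l.tails.tail, ∀ ω : ι → X,
      ∫ v, Real.sqrt (q c.1 (update ω c.1 v) * coordAvg μ c.2.toFinset F (update ω c.1 v)) ∂μ
        ≤ Real.sqrt (1 - t c.1 ^ 2) * Real.sqrt (coordAvg μ (c.1 :: c.2).toFinset F ω) := by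
    intro c hc ω
    have hnot : c.1 ∉ c.2.toFinset := by
      rw [List.mem_toFinset]
      exact fun hb => rel_of_mem_zip_tails (R := fun a b => a ≠ b) l hl c hc c.1 hb rfl
    have hMpos : ∀ ω, 0 < coordAvg μ (insert c.1 c.2.toFinset) F ω := fun ω =>
      (coordAvg_pos_of_le μ (insert c.1 c.2.toFinset) hFm hcF hFlo hFhi ω).1
    have h := step_affinity_le_of_tv μ hnot (hqm c.1) (hq0 c.1) (hqb c.1) (hq1 c.1) hFm hF0 hFhi hMpos
      (ht0 c.1) (by simpa only [List.toFinset_cons] using htv c hc) ω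
    simpa only [List.toFinset_cons] using h
  have hmain := meanAccept_arHybrid_le_prod_sq μ hqm hq0 hqb hCq hFm hF0 hFhi hZpos hθ0 l hl hpw hθ
  refine hmain.trans (le_of_eq ?_)
  rw [sq, ← List.prod_map_mul]
  congr 1
  refine List.map_congr_left fun a _ => ?_
  exact Real.mul_self_sqrt (by nlinarith [ht0 a, ht1 a])

/-- **Exponential form**: under the hypotheses of `meanAccept_arHybrid_le_prod_one_sub_sq`,
`ā ≤ exp(−Σ_k t_{a_k}²)` — `m` coordinates with a uniform total-variation deficit `t` force
`ā ≤ e^{−mt²}`. [ours] -/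
theorem meanAccept_arHybrid_le_exp_neg_sum_sq {q : ι → (ι → X) → ℝ} (hqm : ∀ a, Measurable (q a))
    (hq0 : ∀ a ω, 0 ≤ q a ω) {Cq : ℝ} (hqb : ∀ a ω, q a ω ≤ Cq) (hCq : 0 ≤ Cq)
    (hq1 : ∀ a ω, ∫ v, q a (update ω a v) ∂μ = 1)
    {F : (ι → X) → ℝ} (hFm : Measurable F) {cF CF : ℝ} (hcF : 0 < cF) (hFlo : ∀ ω, cF ≤ F ω)
    (hFhi : ∀ ω, F ω ≤ CF) {t : ι → ℝ} (ht0 : ∀ a, 0 ≤ t a) (ht1 : ∀ a, t a ≤ 1)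
    (l : List ι) (hl : l.Nodup) (hpw : l.Pairwise (fun a b => ∀ ω v, q a (update ω b v) = q a ω))
    (htv : ∀ c ∈ l.zip l.tails.tail, ∀ ω : ι → X,
      2 * t c.1 * coordAvg μ (c.1 :: c.2).toFinset F ω ≤
        ∫ v, |coordAvg μ c.2.toFinset F (update ω c.1 v) -
          q c.1 (update ω c.1 v) * coordAvg μ (c.1 :: c.2).toFinset F (update ω c.1 v)| ∂μ) :
    ∫ x, ∫ y, min
        (F x / (∫ ω, F ω ∂Measure.pi (fun _ : ι => μ)) *
          ((l.map fun b => q b y).prod * coordAvg μ l.toFinset F y /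
            ∫ ω, F ω ∂Measure.pi (fun _ : ι => μ)))
        (F y / (∫ ω, F ω ∂Measure.pi (fun _ : ι => μ)) *
          ((l.map fun b => q b x).prod * coordAvg μ l.toFinset F x /
            ∫ ω, F ω ∂Measure.pi (fun _ : ι => μ)))
        ∂Measure.pi (fun _ : ι => μ) ∂Measure.pi (fun _ : ι => μ)
      ≤ Real.exp (-(l.map fun a => t a ^ 2).sum) := by
  have h := meanAccept_arHybrid_le_prod_one_sub_sq μ hqm hq0 hqb hCq hq1 hFm hcF hFlo hFhi ht0 ht1 l hl
    hpw htv
  refine h.trans ?_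
  -- `∏(1 − t²) ≤ exp(−Σ t²)` from `1 − x ≤ e^{−x}`
  have key : ∀ l' : List ι, (l'.map fun a => 1 - t a ^ 2).prod ≤ Real.exp (-(l'.map fun a => t a ^ 2).sum) := by
    intro l'
    induction l' with
    | nil => simp
    | cons a l'' ih =>
      simp only [List.map_cons, List.prod_cons, List.sum_cons, neg_add, Real.exp_add]
      have h1 : 1 - t a ^ 2 ≤ Real.exp (-(t a ^ 2)) := by
        have := Real.add_one_le_exp (-(t a ^ 2)); linarith
      have h0 : 0 ≤ 1 - t a ^ 2 := by nlinarith [ht0 a, ht1 a]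
      have hP0 : 0 ≤ (l''.map fun a => 1 - t a ^ 2).prod := List.prod_nonneg (fun x hx => by
        obtain ⟨b, _, rfl⟩ := List.mem_map.1 hx; nlinarith [ht0 b, ht1 b])
      exact mul_le_mul h1 ih hP0 (Real.exp_pos _).le
  exact key l

end Summit.Ventures.LatticeQCDFlow.Theory2.Autoregressive

end
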